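import Literature.NumberTheory.LFunctions.Polymath15EffectiveApproximation
import Mathlib.Analysis.SpecialFunctions.Complex.LogDeriv
import Mathlib.Analysis.Calculus.MeanValue
import Mathlib.Analysis.Complex.RealDeriv
import HarnessLib

/-!
# Polymath 15, Theorem 1.3: the parameter bounds (1.10)–(1.12) for `γ`, `Re s_*`, `κ` (proved)

Trunk T-ANT (`Literature/NumberTheory/LFunctions`); companion ("Proofs") file of
`Polymath15EffectiveApproximation.lean`, which vendored the objects of Polymath 15, §1 and
Thm. 1.3 as named facts. Here three of the four named facts of Thm. 1.3 — all but the
Riemann–Siegel approximation `effective_approximation` itself — are PROVED from the definitions: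

* `Polymath15.re_sStar_bound_holds` — (1.11)
  `Re s_* ≥ (1+y)/2 + (t/4) log(x/4π) − (t/(2x²)) (1 − 3y + 4y(1+y)/x²)_+` in the region (1.6).
  Printed proof (Prop. 6.6 (ii)): the closed form
  `Re α(s₊) = (1+y)/((1+y)²+x²) − 2(1−y)/((1−y)²+x²) + (1/2) log(√((1+y)²+x²)/4π)`
  (`re_alpha_sPlus`) and elementary inequalities. The printed argument bounds
  `log √((1+y)²+x²) ≥ log x` and so literally yields the variant with `8y(1−y)` printed in
  Prop. 6.6 (ii); to reach the form (1.11) stated in Thm. 1.3 we keep the slack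
  `(1/2) log(1 + (1+y)²/x²) ≥ (1/2)(1+y)²/((1+y)²+x²)` of the logarithm (`log_sqrt_div_ge`), after
  which `x ≥ 200` leaves room (`rational_part_bound`).
* `Polymath15.kappa_bound_holds` — (1.12) `|κ| ≤ ty/(2(x − 6))`. Printed proof (Prop. 6.6 (iii),
  eqs. (alpha-deriv), (alpha-deriv-bound)): `α'(s) = −1/(2s²) − 1/(s−1)² + 1/(2s)`
  (`hasDerivAt_alpha`), `|α'(σ + ix/2)| ≤ 2/x² + 4/x² + 1/x ≤ 1/(x − 6)` (`norm_deriv_alpha_le`),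
  and the mean value inequality on the horizontal segment from `(1 − y + ix)/2` to `(1 + y + ix)/2`
  (`norm_alpha_sub_alpha_le`).
* `Polymath15.gamma_bound_holds` — (1.10) `|γ| ≤ e^{0.02y} (x/4π)^{−y/2}`. Printed proof
  (Prop. 6.6 (i)): `M_t = M_t^*` (`Mt_conj`), so `log|γ|` is minus the integral of
  `(d/dσ) log|M_t(σ + ix/2)| = Re((t/2) α α' + α)` over `σ ∈ [(1−y)/2, (1+y)/2]`; we use the
  printed branch `log M₀` of eq. (logM) (`logM₀`, `M₀_eq_exp_logM₀`, `hasDerivAt_logM₀ : (log M₀)' =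
  α`) and bound the integrand below by `(1/2) log(x/4π) − 0.02` (`re_deriv_logMt_ge`). Deviation
  from print: the printed expansion `α(ix/2) = O_≤(1/x) + O_≤(1/x) + (1/2) Log(ix/4π)` undercounts
  the term `1/(s − 1)` (of size `2/x`), and with the corrected constant the printed crude route
  gives `0.0235 > 0.02` at `x = 200`; taking the real parts of `1/(2s)` and `1/(s − 1)` exactly
  (`re_alpha_ge`: they are `≥ 0` and `≥ −4/x²`) instead gives the integrand bound with room
  (`numeric_bound`: `≤ 0.0066` at `x = 200`), so (1.10) holds as stated.

## References

* D. H. J. Polymath, *Effective approximation of heat flow evolution of the Riemann `ξ` function,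
  and a new upper bound for the de Bruijn–Newman constant*, Res. Math. Sci. 6 (2019), Paper 31
  (arXiv:1904.12438): Thm. 1.3, §1 eqs. (logM), (alpha-def)–(Mt-def), §6.1 eqs. (alpha-deriv),
  (alpha-deriv-bound), §6.3, Prop. 6.6 (i)–(iii) and their proofs.
-/

noncomputable section

open Complex

open scoped Real ComplexConjugate

namespace Literature.NumberTheory.LFunctions

namespace Polymath15

/-! ## The bound for `Re s_*` (Thm. 1.3, (1.11); Prop. 6.6 (ii)) -/

/-- `s₊ = ((1 + y)/2, −x/2)` in Cartesian form. [cite: Polymath2019, Cor. 6.4] -/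
theorem sPlus_eq (x y : ℝ) : sPlus x y = ⟨(1 + y) / 2, -x / 2⟩ := by
  apply Complex.ext <;> simp [sPlus, neg_div]

/-- The closed form of `Re α(s₊)` used in the proof of Prop. 6.6 (ii):
`Re α(s₊) = (1+y)/((1+y)²+x²) − 2(1−y)/((1−y)²+x²) + (1/2) log(√((1+y)²+x²)/(4π))`.
[cite: Polymath2019, Prop. 6.6 (ii), proof] -/
theorem re_alpha_sPlus (x y : ℝ) (hx : 0 < x) :
    (alpha (sPlus x y)).re =
      (1 + y) / ((1 + y) ^ 2 + x ^ 2) - 2 * (1 - y) / ((1 - y) ^ 2 + x ^ 2) +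
        1 / 2 * Real.log (Real.sqrt ((1 + y) ^ 2 + x ^ 2) / (4 * π)) := by
  have h2s : 2 * sPlus x y = ⟨1 + y, -x⟩ := by
    rw [sPlus_eq]
    apply Complex.ext
    · simp; ring
    · simp; ring
  have hs1 : sPlus x y - 1 = ⟨-(1 - y) / 2, -x / 2⟩ := by
    rw [sPlus_eq]
    apply Complex.ext
    · simp; ring
    · simp
  have hnorm : ‖sPlus x y / (2 * π)‖ = Real.sqrt ((1 + y) ^ 2 + x ^ 2) / (4 * π) := by
    rw [norm_div, sPlus_eq]
    have : ‖(2 * π : ℂ)‖ = 2 * π := by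
      rw [show (2 * π : ℂ) = ((2 * π : ℝ) : ℂ) by push_cast; ring, Complex.norm_real,
        Real.norm_of_nonneg (by positivity)]
    rw [this, Complex.norm_def, Complex.normSq_mk]
    rw [show (1 + y) / 2 * ((1 + y) / 2) + -x / 2 * (-x / 2) = ((1 + y) ^ 2 + x ^ 2) / 4 by ring,
      Real.sqrt_div' _ (by norm_num : (0:ℝ) ≤ 4), show (4 : ℝ) = 2 ^ 2 by norm_num,
      Real.sqrt_sq (by norm_num : (0:ℝ) ≤ 2)]
    ring
  simp only [alpha, Complex.add_re, one_div, Complex.inv_re, h2s, hs1, Complex.normSq_mk,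
    Complex.mul_re, Complex.log_re, hnorm]
  norm_num
  field_simp
  ring


/-- `Re s_* = (1 + y)/2 + (t/2) Re α(s₊)` (from the definition (sn-def) of `s_*`).
[cite: Polymath2019, Thm. 1.3] -/
theorem re_sStar (t x y : ℝ) :
    (sStar t x y).re = (1 + y) / 2 + t / 2 * (alpha (sPlus x y)).re := by
  have h1 : (sPlus x y).re = (1 + y) / 2 := by rw [sPlus_eq]
  have h2 : ((t : ℂ) / 2 * alpha (sPlus x y)).re = t / 2 * (alpha (sPlus x y)).re := by
    rw [show (t : ℂ) / 2 = ((t / 2 : ℝ) : ℂ) by push_cast; ring, Complex.re_ofReal_mul]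
  rw [sStar, Complex.add_re, h1, h2]

/-- The logarithmic slack kept in our proof of (1.11):
`log(x/4π) + (1/2)·(1+y)²/((1+y)²+x²) ≤ log(√((1+y)²+x²)/(4π))`, from `1 − 1/u ≤ log u`.
[folklore] -/
theorem log_sqrt_div_ge {x y : ℝ} (hx : 0 < x) :
    Real.log (x / (4 * π)) + 1 / 2 * ((1 + y) ^ 2 / ((1 + y) ^ 2 + x ^ 2)) ≤
      Real.log (Real.sqrt ((1 + y) ^ 2 + x ^ 2) / (4 * π)) := by
  have hA : 0 < (1 + y) ^ 2 + x ^ 2 := by positivity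
  have h4π : (4 * π : ℝ) ≠ 0 := by positivity
  have hsq : Real.sqrt ((1 + y) ^ 2 + x ^ 2) ≠ 0 := (Real.sqrt_pos.2 hA).ne'
  rw [Real.log_div hsq h4π, Real.log_sqrt hA.le, Real.log_div hx.ne' h4π]
  have hlow := Real.one_sub_inv_le_log_of_pos (div_pos hA (pow_pos hx 2))
  rw [inv_div, Real.log_div hA.ne' (pow_ne_zero 2 hx.ne'), Real.log_pow] at hlow
  have : 1 - x ^ 2 / ((1 + y) ^ 2 + x ^ 2) = (1 + y) ^ 2 / ((1 + y) ^ 2 + x ^ 2) := by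
    field_simp
    ring
  rw [this] at hlow
  push_cast at hlow
  linarith

/-- The elementary inequality behind (1.11): for `x ≥ 200`, `0 ≤ y ≤ 1` and `m ≥ 1 − 3y`,
`−m/x² ≤ (1+y)/((1+y)²+x²) − 2(1−y)/((1−y)²+x²) + (1/4)(1+y)²/((1+y)²+x²)`. [folklore] -/
theorem rational_part_bound {x y m : ℝ} (hx : 200 ≤ x) (hy0 : 0 ≤ y) (hy1 : y ≤ 1)
    (hm : 1 - 3 * y ≤ m) :
    -(m / x ^ 2) ≤ (1 + y) / ((1 + y) ^ 2 + x ^ 2) - 2 * (1 - y) / ((1 - y) ^ 2 + x ^ 2) +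
      1 / 4 * ((1 + y) ^ 2 / ((1 + y) ^ 2 + x ^ 2)) := by
  have hxpos : 0 < x := by linarith
  have hx2 : 0 < x ^ 2 := by positivity
  have hA : 0 < (1 + y) ^ 2 + x ^ 2 := by positivity
  have hB : 0 < (1 - y) ^ 2 + x ^ 2 := by positivity
  have key1 : (1 + y + 0.24) / x ^ 2 ≤
      (1 + y) / ((1 + y) ^ 2 + x ^ 2) + 1 / 4 * ((1 + y) ^ 2 / ((1 + y) ^ 2 + x ^ 2)) := by
    have : (1 + y) / ((1 + y) ^ 2 + x ^ 2) + 1 / 4 * ((1 + y) ^ 2 / ((1 + y) ^ 2 + x ^ 2)) =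
        (4 * (1 + y) + (1 + y) ^ 2) / (4 * ((1 + y) ^ 2 + x ^ 2)) := by
      field_simp
    rw [this, div_le_div_iff₀ hx2 (by positivity)]
    have hx2' : (40000 : ℝ) ≤ x ^ 2 := by nlinarith
    have hc : (0 : ℝ) ≤ (1 + y) ^ 2 - 0.96 := by nlinarith
    nlinarith [mul_le_mul_of_nonneg_right hx2' hc, hy0, hy1, mul_nonneg hy0 hy0,
      mul_nonneg (mul_nonneg hy0 hy0) hy0]
  have key2 : 2 * (1 - y) / ((1 - y) ^ 2 + x ^ 2) ≤ 2 * (1 - y) / x ^ 2 :=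
    div_le_div_of_nonneg_left (by linarith) hx2 (by nlinarith)
  have key3 : -(m / x ^ 2) ≤ (1 + y + 0.24) / x ^ 2 - 2 * (1 - y) / x ^ 2 := by
    rw [← neg_div, ← sub_div, div_le_div_iff_of_pos_right hx2]
    linarith
  linarith

/-- **Proof of `re_sStar_bound` (Polymath 15, Thm. 1.3, (1.11); Prop. 6.6 (ii)).** In the region
(1.6), `Re s_* ≥ (1+y)/2 + (t/4) log(x/4π) − (t/(2x²)) (1 − 3y + 4y(1+y)/x²)_+`: by `re_sStar`,
`re_alpha_sPlus`, `log_sqrt_div_ge` and `rational_part_bound` (with `m` the positive part, which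
is `≥ 1 − 3y`). [cite: Polymath2019, Thm. 1.3 and Prop. 6.6 (ii)] -/
theorem re_sStar_bound_holds : re_sStar_bound := by
  rintro t x y ⟨ht, -, hy0, hy1, hx⟩
  have hxpos : 0 < x := by linarith
  rw [re_sStar, re_alpha_sPlus x y hxpos]
  have hlog := log_sqrt_div_ge (y := y) hxpos
  have hm : 1 - 3 * y ≤ max (1 - 3 * y + 4 * y * (1 + y) / x ^ 2) 0 :=
    le_trans (le_add_of_nonneg_right (by positivity)) (le_max_left _ _)
  have hrat := rational_part_bound hx hy0 hy1 hm
  have ht2 : 0 ≤ t / 2 := by linarith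
  have e1 := mul_le_mul_of_nonneg_left hlog ht2
  have e2 := mul_le_mul_of_nonneg_left hrat ht2
  have hsplit : t / (2 * x ^ 2) * max (1 - 3 * y + 4 * y * (1 + y) / x ^ 2) 0 =
      t / 2 * (max (1 - 3 * y + 4 * y * (1 + y) / x ^ 2) 0 / x ^ 2) := by ring
  rw [hsplit]
  linarith [e1, e2]


/-! ## The bound for `κ` (Thm. 1.3, (1.12); Prop. 6.6 (iii)) -/

/-- `α'(s) = −1/(2s²) − 1/(s − 1)² + 1/(2s)` (eq. (alpha-deriv) of §6.1), here for `Im s > 0`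
(so that `s ≠ 0, 1` and `s/(2π)` is off the branch cut).
[cite: Polymath2019, §6.1, eq. (alpha-deriv)] -/
theorem hasDerivAt_alpha {s : ℂ} (hs : 0 < s.im) :
    HasDerivAt alpha (-(1 / (2 * s ^ 2)) - 1 / (s - 1) ^ 2 + 1 / (2 * s)) s := by
  have hs0 : s ≠ 0 := fun h ↦ by simp [h] at hs
  have h2s : (2 : ℂ) * s ≠ 0 := mul_ne_zero two_ne_zero hs0
  have hs1 : s - 1 ≠ 0 := by
    intro h
    have := congrArg Complex.im h
    simp at this
    linarith
  have hπ : (2 * π : ℂ) ≠ 0 := by exact_mod_cast (by positivity : (2 * π : ℝ) ≠ 0)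
  have hslit : s / (2 * π) ∈ Complex.slitPlane := by
    rw [Complex.mem_slitPlane_iff]
    right
    rw [show (2 * π : ℂ) = ((2 * π : ℝ) : ℂ) by push_cast; ring, Complex.div_ofReal_im]
    positivity
  have h1 := (hasDerivAt_const s (1 : ℂ)).div ((hasDerivAt_id' s).const_mul (2 : ℂ)) h2s
  have h2 := (hasDerivAt_const s (1 : ℂ)).div ((hasDerivAt_id' s).sub_const (1 : ℂ)) hs1
  have h3 : HasDerivAt (fun z : ℂ ↦ 1 / 2 * Complex.log (z / (2 * π)))
      (1 / 2 * ((s / (2 * π))⁻¹ * (1 / (2 * π)))) s := by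
    have hl := (Complex.hasDerivAt_log hslit).comp s ((hasDerivAt_id' s).div_const (2 * π))
    simpa using hl.const_mul (1 / 2 : ℂ)
  have hsum := (h1.add h2).add h3
  refine (hsum.congr_of_eventuallyEq (Filter.Eventually.of_forall fun z ↦ rfl)).congr_deriv ?_
  field_simp
  ring

/-- The bound (alpha-deriv-bound)/(alphap-b): on the line `Im s = x/2`, `x ≥ 200`,
`|α'(s)| ≤ 1/(2 Im(s)²) + 1/Im(s)² + 1/(2 Im s) ≤ 1/(2 Im s − 6) = 1/(x − 6)`.
[cite: Polymath2019, §6.1, eq. (alpha-deriv-bound)] -/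
theorem norm_deriv_alpha_le {x : ℝ} (hx : 200 ≤ x) {s : ℂ} (hs : s.im = x / 2) :
    ‖-(1 / (2 * s ^ 2)) - 1 / (s - 1) ^ 2 + 1 / (2 * s)‖ ≤ 1 / (x - 6) := by
  have hxpos : 0 < x := by linarith
  have hns : x / 2 ≤ ‖s‖ := by
    have := Complex.abs_im_le_norm s
    rwa [hs, abs_of_pos (by positivity)] at this
  have hns1 : x / 2 ≤ ‖s - 1‖ := by
    have := Complex.abs_im_le_norm (s - 1)
    rwa [Complex.sub_im, Complex.one_im, sub_zero, hs, abs_of_pos (by positivity)] at this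
  have hspos : 0 < ‖s‖ := by linarith
  have hs1pos : 0 < ‖s - 1‖ := by linarith
  have e1 : ‖-(1 / (2 * s ^ 2))‖ ≤ 2 / x ^ 2 := by
    rw [norm_neg, norm_div, norm_mul, norm_pow, Complex.norm_two, norm_one]
    rw [div_le_div_iff₀ (by positivity) (by positivity)]
    nlinarith [mul_le_mul hns hns (by positivity) (norm_nonneg _)]
  have e2 : ‖1 / (s - 1) ^ 2‖ ≤ 4 / x ^ 2 := by
    rw [norm_div, norm_pow, norm_one, div_le_div_iff₀ (by positivity) (by positivity)]
    nlinarith [mul_le_mul hns1 hns1 (by positivity) (norm_nonneg _)]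
  have e3 : ‖1 / (2 * s)‖ ≤ 1 / x := by
    rw [norm_div, norm_mul, Complex.norm_two, norm_one, div_le_div_iff₀ (by positivity) hxpos]
    linarith
  have e4 : 2 / x ^ 2 + 4 / x ^ 2 + 1 / x ≤ 1 / (x - 6) := by
    rw [← add_div, div_add_div _ _ (by positivity) hxpos.ne',
      div_le_div_iff₀ (by positivity) (by linarith)]
    nlinarith
  have tri : ‖-(1 / (2 * s ^ 2)) - 1 / (s - 1) ^ 2 + 1 / (2 * s)‖ ≤
      ‖-(1 / (2 * s ^ 2))‖ + ‖1 / (s - 1) ^ 2‖ + ‖1 / (2 * s)‖ := by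
    have := norm_add_le (-(1 / (2 * s ^ 2)) - 1 / (s - 1) ^ 2) (1 / (2 * s))
    have := norm_sub_le (-(1 / (2 * s ^ 2))) (1 / (s - 1) ^ 2)
    linarith
  linarith

/-- Mean value inequality for `α` along the horizontal line `Im s = x/2` (`x ≥ 200`):
`|α(w) − α(z)| ≤ |w − z|/(x − 6)` ("the fundamental theorem of calculus", proof of Prop. 6.6 (iii)).
[cite: Polymath2019, Prop. 6.6 (iii), proof] -/
theorem norm_alpha_sub_alpha_le {x : ℝ} (hx : 200 ≤ x) {z w : ℂ} (hz : z.im = x / 2)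
    (hw : w.im = x / 2) : ‖alpha w - alpha z‖ ≤ 1 / (x - 6) * ‖w - z‖ := by
  have hconv : Convex ℝ {u : ℂ | u.im = x / 2} := by
    intro u hu v hv a b _ _ hab
    simp only [Set.mem_setOf_eq] at hu hv ⊢
    rw [Complex.add_im, Complex.real_smul, Complex.real_smul, Complex.im_ofReal_mul,
      Complex.im_ofReal_mul, hu, hv, ← add_mul, hab, one_mul]
  have hpos : ∀ u ∈ {u : ℂ | u.im = x / 2}, 0 < u.im := by
    intro u hu
    simp only [Set.mem_setOf_eq] at hu
    rw [hu]
    linarith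
  exact hconv.norm_image_sub_le_of_norm_hasDerivWithin_le
    (fun u hu ↦ (hasDerivAt_alpha (hpos u hu)).hasDerivWithinAt)
    (fun u hu ↦ norm_deriv_alpha_le hx hu) hz hw

/-- **Proof of `kappa_bound` (Polymath 15, Thm. 1.3, (1.12); Prop. 6.6 (iii)).** In the region
(1.6), `|κ| ≤ ty/(2(x − 6))`: `κ = (t/2)(α(s₋) − α(s₋ + y))` with `s₋ = (1 − y + ix)/2`, and
`norm_alpha_sub_alpha_le`. [cite: Polymath2019, Thm. 1.3 and Prop. 6.6 (iii)] -/
theorem kappa_bound_holds : kappa_bound := by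
  rintro t x y ⟨ht, -, hy0, -, hx⟩
  have hz : (sMinus x y).im = x / 2 := by simp [sMinus]
  have hw : ((1 + y + x * I) / 2 : ℂ).im = x / 2 := by simp
  have hmvt := norm_alpha_sub_alpha_le hx hz hw
  have hdiff : ‖((1 + y + x * I) / 2 : ℂ) - sMinus x y‖ = y := by
    rw [sMinus, show ((1 + y + x * I) / 2 : ℂ) - (1 - y + x * I) / 2 = (y : ℂ) by ring,
      Complex.norm_real, Real.norm_of_nonneg hy0]
  have ht2 : ‖(t : ℂ) / 2‖ = t / 2 := by
    rw [norm_div, Complex.norm_real, Complex.norm_two, Real.norm_of_nonneg ht.le]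
  rw [kappa, norm_mul, norm_sub_rev, ht2]
  rw [hdiff] at hmvt
  calc t / 2 * ‖alpha ((1 + y + x * I) / 2) - alpha (sMinus x y)‖
      ≤ t / 2 * (1 / (x - 6) * y) := by gcongr
    _ = t * y / (2 * (x - 6)) := by
      have : x - 6 ≠ 0 := by linarith
      field_simp

/-! ## The bound for `γ` (Thm. 1.3, (1.10); Prop. 6.6 (i)) -/

/-! ### `M_t = M_t^*` -/

/-- A complex number off the real axis is off the branch cut of `Log`. [folklore] -/
theorem arg_ne_pi_of_im_ne_zero {z : ℂ} (hz : z.im ≠ 0) : z.arg ≠ π := by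
  rw [Ne, Complex.arg_eq_pi_iff, not_and_or]
  exact Or.inr hz

/-- `α(s̄) = conj α(s)` off the real axis ("`α = α^*`", §6.3). [cite: Polymath2019, §6.3] -/
theorem alpha_conj {s : ℂ} (hs : s.im ≠ 0) : alpha (conj s) = conj (alpha s) := by
  have h1 : (s / (2 * π)).im ≠ 0 := by
    rw [show (2 * π : ℂ) = ((2 * π : ℝ) : ℂ) by push_cast; ring, Complex.div_ofReal_im]
    exact div_ne_zero hs (by positivity)
  have hlog : Complex.log (conj s / (2 * π)) = conj (Complex.log (s / (2 * π))) := by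
    rw [show conj s / (2 * π) = conj (s / (2 * π)) by
      rw [map_div₀, map_mul, Complex.conj_ofReal, map_ofNat],
      Complex.log_conj _ (arg_ne_pi_of_im_ne_zero h1)]
  simp only [alpha, hlog, map_add, map_div₀, map_mul, map_sub, map_one, map_ofNat]

/-- `M₀(s̄) = conj M₀(s)` off the real axis ("`M₀ = M₀^*`", §6.3). [cite: Polymath2019, §6.3] -/
theorem M₀_conj {s : ℂ} (hs : s.im ≠ 0) : M₀ (conj s) = conj (M₀ s) := by
  have h2 : (s / 2).im ≠ 0 := by rw [Complex.div_ofNat_im]; exact div_ne_zero hs two_ne_zero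
  have hlog : Complex.log (conj s / 2) = conj (Complex.log (s / 2)) := by
    rw [show conj s / 2 = conj (s / 2) by rw [map_div₀, map_ofNat],
      Complex.log_conj _ (arg_ne_pi_of_im_ne_zero h2)]
  have hπarg : (π : ℂ).arg ≠ π := by
    rw [Complex.arg_ofReal_of_nonneg Real.pi_pos.le]; exact Real.pi_ne_zero.symm
  have hcpow : (π : ℂ) ^ (-conj s / 2) = conj ((π : ℂ) ^ (-s / 2)) := by
    rw [show -conj s / 2 = conj (-s / 2) by rw [map_div₀, map_neg, map_ofNat],
      Complex.cpow_conj _ _ hπarg, Complex.conj_ofReal]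
  simp only [M₀, hlog, hcpow, ← Complex.exp_conj, map_mul, map_div₀, map_sub, map_one, map_ofNat,
    Complex.conj_ofReal]

/-- `M_t(s̄) = conj M_t(s)` off the real axis ("`M_t = M_t^*`", §6.3; used in the proof of
Prop. 6.6 (i) as `|M_t((1+y−ix)/2)| = |M_t((1+y+ix)/2)|`). [cite: Polymath2019, §6.3] -/
theorem Mt_conj (t : ℝ) {s : ℂ} (hs : s.im ≠ 0) : Mt t (conj s) = conj (Mt t s) := by
  rw [Mt, Mt, alpha_conj hs, M₀_conj hs, map_mul, ← Complex.exp_conj, map_mul, map_pow, map_div₀,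
    Complex.conj_ofReal, map_ofNat]

/-- `|M_t(s̄)| = |M_t(s)|` off the real axis. [cite: Polymath2019, Prop. 6.6 (i), proof] -/
theorem norm_Mt_conj (t : ℝ) {s : ℂ} (hs : s.im ≠ 0) : ‖Mt t (conj s)‖ = ‖Mt t s‖ := by
  rw [Mt_conj t hs, Complex.norm_conj]

/-! ### The branch `log M_t = (t/4) α² + log M₀` and its derivative -/

/-- The holomorphic branch of `log M₀` on `ℂ ∖ (−∞, 1]` printed as eq. (logM):
`log M₀(s) = Log s + Log(s − 1) − (s/2) log π + log(√(2π)/16) + (s/2 − 1/2) Log(s/2) − s/2`.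
[cite: Polymath2019, §1, eq. (logM)] -/
def logM₀ (s : ℂ) : ℂ :=
  Complex.log ((Real.sqrt (2 * π) / 16 : ℝ) : ℂ) + Complex.log s + Complex.log (s - 1) -
    s / 2 * (Real.log π : ℂ) + ((s / 2 - 1 / 2) * Complex.log (s / 2) - s / 2)

/-- The corresponding branch of `log M_t = (t/4) α² + log M₀` (from (Mt-def)).
[cite: Polymath2019, §1, eq. (Mt-def)] -/
def logMt (t : ℝ) (s : ℂ) : ℂ := t / 4 * alpha s ^ 2 + logM₀ s

/-- `M₀ = exp(log M₀)` for `s ≠ 0, 1` (the defining property of the branch (logM)).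
[cite: Polymath2019, §1, eq. (logM)] -/
theorem M₀_eq_exp_logM₀ {s : ℂ} (h0 : s ≠ 0) (h1 : s ≠ 1) : M₀ s = Complex.exp (logM₀ s) := by
  have hc : ((Real.sqrt (2 * π) / 16 : ℝ) : ℂ) ≠ 0 := by
    exact_mod_cast (by positivity : Real.sqrt (2 * π) / 16 ≠ 0)
  have hπ : (π : ℂ) ≠ 0 := by exact_mod_cast Real.pi_ne_zero
  have hcpow : (π : ℂ) ^ (-s / 2) = Complex.exp (-(s / 2 * (Real.log π : ℂ))) := by
    rw [Complex.cpow_def_of_ne_zero hπ, ← Complex.ofReal_log Real.pi_pos.le]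
    ring_nf
  rw [logM₀, Complex.exp_add, Complex.exp_sub, Complex.exp_add, Complex.exp_add,
    Complex.exp_log hc, Complex.exp_log h0, Complex.exp_log (sub_ne_zero.2 h1), M₀, hcpow,
    Complex.exp_neg]
  push_cast
  field_simp
  ring

/-- `M_t = exp(log M_t)` for `s ≠ 0, 1`. [cite: Polymath2019, §1, eq. (Mt-def)] -/
theorem Mt_eq_exp_logMt (t : ℝ) {s : ℂ} (h0 : s ≠ 0) (h1 : s ≠ 1) :
    Mt t s = Complex.exp (logMt t s) := by
  rw [Mt, logMt, Complex.exp_add, M₀_eq_exp_logM₀ h0 h1]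

/-- `|M_t(s)| = exp(Re log M_t(s))` for `s ≠ 0, 1`. [cite: Polymath2019, Prop. 6.6 (i), proof] -/
theorem norm_Mt_eq_exp (t : ℝ) {s : ℂ} (h0 : s ≠ 0) (h1 : s ≠ 1) :
    ‖Mt t s‖ = Real.exp (logMt t s).re := by
  rw [Mt_eq_exp_logMt t h0 h1, Complex.norm_exp]

/-- `(log M₀)' = α` ("differentiating (logM), we see that the logarithmic derivative of `M₀` is
given by (alpha-form)"), here on the upper half-plane.
[cite: Polymath2019, §1, eqs. (alpha-def)–(alpha-form)] -/
theorem hasDerivAt_logM₀ {s : ℂ} (hs : 0 < s.im) : HasDerivAt logM₀ (alpha s) s := by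
  have hs0 : s ≠ 0 := fun h ↦ by simp [h] at hs
  have hs1 : s - 1 ≠ 0 := by
    intro h
    have := congrArg Complex.im h
    simp at this
    linarith
  have hπ : (π : ℂ) ≠ 0 := by exact_mod_cast Real.pi_ne_zero
  have hslit0 : s ∈ Complex.slitPlane := Complex.mem_slitPlane_iff.2 (Or.inr hs.ne')
  have hslit1 : s - 1 ∈ Complex.slitPlane :=
    Complex.mem_slitPlane_iff.2 (Or.inr (by simpa using hs.ne'))
  have hslit2 : s / 2 ∈ Complex.slitPlane :=
    Complex.mem_slitPlane_iff.2 (Or.inr (by rw [Complex.div_ofNat_im]; positivity))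
  have hA : HasDerivAt (fun z : ℂ ↦ Complex.log ((Real.sqrt (2 * π) / 16 : ℝ) : ℂ) + Complex.log z +
      Complex.log (z - 1) - z / 2 * (Real.log π : ℂ))
      (0 + s⁻¹ + (s - 1)⁻¹ * 1 - 1 / 2 * (Real.log π : ℂ)) s := by
    refine (((hasDerivAt_const s _).add (Complex.hasDerivAt_log hslit0)).add
      ((Complex.hasDerivAt_log hslit1).comp s ((hasDerivAt_id' s).sub_const 1))).sub ?_
    exact ((hasDerivAt_id' s).div_const 2).mul_const (Real.log π : ℂ)
  have hB : HasDerivAt (fun z : ℂ ↦ (z / 2 - 1 / 2) * Complex.log (z / 2) - z / 2)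
      ((1 / 2) * Complex.log (s / 2) + (s / 2 - 1 / 2) * ((s / 2)⁻¹ * (1 / 2)) - 1 / 2) s := by
    have hl := (Complex.hasDerivAt_log hslit2).comp s ((hasDerivAt_id' s).div_const 2)
    have hlin : HasDerivAt (fun z : ℂ ↦ z / 2 - 1 / 2) (1 / 2) s :=
      ((hasDerivAt_id' s).div_const 2).sub_const (1 / 2 : ℂ)
    exact (hlin.mul hl).sub ((hasDerivAt_id' s).div_const 2)
  have hsum := hA.add hB
  refine (hsum.congr_of_eventuallyEq (Filter.Eventually.of_forall fun z ↦ rfl)).congr_deriv ?_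
  -- the identity  1/s + 1/(s-1) - (log π)/2 + (1/2) log (s/2) + (s/2 - 1/2)/s - 1/2 = α(s)
  have hlogdiv : Complex.log (s / (2 * π)) = Complex.log (s / 2) - (Real.log π : ℂ) := by
    have : s / (2 * π) = ((π⁻¹ : ℝ) : ℂ) * (s / 2) := by
      push_cast
      field_simp
    rw [this, Complex.log_ofReal_mul (by positivity) (div_ne_zero hs0 two_ne_zero), Real.log_inv]
    push_cast
    ring
  rw [alpha, hlogdiv]
  field_simp
  ring

/-- `(log M_t)' = (t/2) α α' + α` on the upper half-plane ("`d/dσ log|M_t(σ + ix/2)| =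
Re((t/2) α α' + α)`", proof of Prop. 6.6 (i)). [cite: Polymath2019, Prop. 6.6 (i), proof] -/
theorem hasDerivAt_logMt (t : ℝ) {s : ℂ} (hs : 0 < s.im) :
    HasDerivAt (logMt t)
      (t / 4 * (2 * alpha s * (-(1 / (2 * s ^ 2)) - 1 / (s - 1) ^ 2 + 1 / (2 * s))) + alpha s)
      s := by
  have h1 := ((hasDerivAt_alpha hs).pow 2).const_mul ((t : ℂ) / 4)
  have h2 := hasDerivAt_logM₀ hs
  refine ((h1.add h2).congr_of_eventuallyEq
    (Filter.Eventually.of_forall fun z ↦ rfl)).congr_deriv ?_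
  norm_num


/-! ### Estimates for `α`, `α'` on the line `Im s = x/2` -/

/-- Lower bound for `Re α` on the line `Im s = x/2`, `0 ≤ Re s ≤ 1`, `x ≥ 200`:
`Re α(s) ≥ (1/2) log(x/4π) − 4/x²` — the real parts of `1/(2s)` (nonnegative) and `1/(s−1)`
(`≥ −4/x²`) taken exactly and `|s/2π| ≥ x/4π`. (The printed proof of Prop. 6.6 (i) expands
`α(σ + ix/2) = (1/2) log(x/4π) + iπ/4 + O_≤((2+σ)/(x−6))` instead; keeping real parts gives more
room.) [cite: Polymath2019, Prop. 6.6 (i), proof] -/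
theorem re_alpha_ge {x : ℝ} (hx : 200 ≤ x) {s : ℂ} (hs : s.im = x / 2) (h0 : 0 ≤ s.re)
    (h1 : s.re ≤ 1) : 1 / 2 * Real.log (x / (4 * π)) - 4 / x ^ 2 ≤ (alpha s).re := by
  have hxpos : 0 < x := by linarith
  -- the term `1/(2s)` has nonnegative real part
  have t1 : 0 ≤ (1 / (2 * s)).re := by
    rw [one_div, Complex.inv_re]
    refine div_nonneg ?_ (Complex.normSq_nonneg _)
    simp only [Complex.mul_re, Complex.re_ofNat, Complex.im_ofNat, zero_mul, sub_zero]
    linarith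
  -- the term `1/(s-1)` has real part `≥ -4/x²`
  have t2 : -(4 / x ^ 2) ≤ (1 / (s - 1)).re := by
    rw [one_div, Complex.inv_re]
    have hnum : -1 ≤ (s - 1).re := by simp; linarith
    have hnum' : (s - 1).re ≤ 0 := by simp; linarith
    have hden : x ^ 2 / 4 ≤ Complex.normSq (s - 1) := by
      rw [Complex.normSq_apply]
      have : (s - 1).im = x / 2 := by simp [hs]
      rw [this]
      nlinarith [mul_self_nonneg (s - 1).re]
    have hden_pos : 0 < x ^ 2 / 4 := by positivity
    calc -(4 / x ^ 2) = -1 / (x ^ 2 / 4) := by ring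
      _ ≤ (s - 1).re / (x ^ 2 / 4) := by
          rw [div_le_div_iff_of_pos_right hden_pos]
          exact hnum
      _ ≤ (s - 1).re / Complex.normSq (s - 1) := by
          have := div_le_div_of_nonneg_left (neg_nonneg.2 hnum') hden_pos hden
          rw [neg_div, neg_div] at this
          linarith
  -- the logarithmic term
  have t3 : 1 / 2 * Real.log (x / (4 * π)) ≤ (1 / 2 * Complex.log (s / (2 * π))).re := by
    have hre : (1 / 2 * Complex.log (s / (2 * π))).re = 1 / 2 * Real.log ‖s / (2 * π)‖ := by
      rw [show (1 / 2 : ℂ) = ((1 / 2 : ℝ) : ℂ) by push_cast; ring, Complex.re_ofReal_mul,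
        Complex.log_re]
    rw [hre]
    have hnorm : x / (4 * π) ≤ ‖s / (2 * π)‖ := by
      rw [norm_div, show (2 * π : ℂ) = ((2 * π : ℝ) : ℂ) by push_cast; ring, Complex.norm_real,
        Real.norm_of_nonneg (by positivity), show x / (4 * π) = (x / 2) / (2 * π) by ring]
      apply div_le_div_of_nonneg_right _ (by positivity)
      have := Complex.abs_im_le_norm s
      rwa [hs, abs_of_pos (by positivity)] at this
    have := Real.log_le_log (by positivity) hnorm
    linarith
  have hsplit : (alpha s).re =
      (1 / (2 * s)).re + (1 / (s - 1)).re + (1 / 2 * Complex.log (s / (2 * π))).re := by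
    simp only [alpha, Complex.add_re]
  rw [hsplit]
  linarith

/-- Crude size bound `|α(s)| ≤ 3/x + (1/2)(log x + π)` on the line `Im s = x/2`, `0 ≤ Re s ≤ 1`,
`x ≥ 200` (from `|1/(2s)| ≤ 1/x`, `|1/(s−1)| ≤ 2/x`, `|Log w| ≤ log|w| + π`).
[cite: Polymath2019, Prop. 6.6 (i), proof] -/
theorem norm_alpha_le {x : ℝ} (hx : 200 ≤ x) {s : ℂ} (hs : s.im = x / 2) (h0 : 0 ≤ s.re)
    (h1 : s.re ≤ 1) : ‖alpha s‖ ≤ 3 / x + 1 / 2 * (Real.log x + π) := by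
  have hxpos : 0 < x := by linarith
  have hns : x / 2 ≤ ‖s‖ := by
    have := Complex.abs_im_le_norm s
    rwa [hs, abs_of_pos (by positivity)] at this
  have hns1 : x / 2 ≤ ‖s - 1‖ := by
    have := Complex.abs_im_le_norm (s - 1)
    rwa [Complex.sub_im, Complex.one_im, sub_zero, hs, abs_of_pos (by positivity)] at this
  have hsle : ‖s‖ ≤ x := by
    have := Complex.norm_le_abs_re_add_abs_im s
    rw [hs, abs_of_nonneg h0, abs_of_pos (by positivity : 0 < x / 2)] at this
    linarith
  have hspos : 0 < ‖s‖ := by linarith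
  have hs1pos : 0 < ‖s - 1‖ := by linarith
  have e1 : ‖1 / (2 * s)‖ ≤ 1 / x := by
    rw [norm_div, norm_mul, Complex.norm_two, norm_one, div_le_div_iff₀ (by positivity) hxpos]
    linarith
  have e2 : ‖1 / (s - 1)‖ ≤ 2 / x := by
    rw [norm_div, norm_one, div_le_div_iff₀ (by linarith) hxpos]
    linarith
  have hπ1 : (1 : ℝ) ≤ 2 * π := by linarith [Real.pi_gt_three]
  have hw_eq : ‖s / (2 * π)‖ = ‖s‖ / (2 * π) := by
    rw [norm_div, show (2 * π : ℂ) = ((2 * π : ℝ) : ℂ) by push_cast; ring, Complex.norm_real,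
      Real.norm_of_nonneg (by positivity)]
  have hw1 : 1 ≤ ‖s / (2 * π)‖ := by
    rw [hw_eq, le_div_iff₀ (by positivity)]
    nlinarith [Real.pi_lt_four]
  have hwx : ‖s / (2 * π)‖ ≤ x := by
    rw [hw_eq, div_le_iff₀ (by positivity)]
    nlinarith [norm_nonneg s]
  have e3 : ‖1 / 2 * Complex.log (s / (2 * π))‖ ≤ 1 / 2 * (Real.log x + π) := by
    rw [norm_mul, show ‖(1 / 2 : ℂ)‖ = 1 / 2 by rw [norm_div, norm_one, Complex.norm_two]]
    gcongr
    calc ‖Complex.log (s / (2 * π))‖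
        ≤ |(Complex.log (s / (2 * π))).re| + |(Complex.log (s / (2 * π))).im| :=
          Complex.norm_le_abs_re_add_abs_im _
      _ = |Real.log ‖s / (2 * π)‖| + |Complex.arg (s / (2 * π))| := by
          rw [Complex.log_re, Complex.log_im]
      _ ≤ Real.log x + π := by
          refine add_le_add ?_ (Complex.abs_arg_le_pi _)
          rw [abs_of_nonneg (Real.log_nonneg hw1)]
          exact Real.log_le_log (by positivity) hwx
  calc ‖alpha s‖ ≤ ‖1 / (2 * s)‖ + ‖1 / (s - 1)‖ + ‖1 / 2 * Complex.log (s / (2 * π))‖ :=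
        norm_add₃_le
    _ ≤ 1 / x + 2 / x + 1 / 2 * (Real.log x + π) := by linarith
    _ = 3 / x + 1 / 2 * (Real.log x + π) := by ring

/-- `log x ≤ x/200 + 5` for `x ≥ 200` (from `log 200 < 6` and `log u ≤ u − 1`). [folklore] -/
theorem log_le_linear {x : ℝ} (hx : 200 ≤ x) : Real.log x ≤ x / 200 + 5 := by
  have hxpos : 0 < x := by linarith
  have h200 : Real.log 200 < 6 := by
    rw [Real.log_lt_iff_lt_exp (by norm_num)]
    have he := Real.exp_one_gt_d9
    have h6 : Real.exp 6 = Real.exp 1 ^ 6 := by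
      rw [← Real.exp_nat_mul]
      norm_num
    rw [h6]
    have hnum : (200 : ℝ) < 2.7182818283 ^ 6 := by norm_num
    exact hnum.trans_le (pow_le_pow_left₀ (by norm_num) he.le 6)
  have hsplit : Real.log x = Real.log (x / 200) + Real.log 200 := by
    rw [← Real.log_mul (by positivity) (by norm_num)]
    congr 1
    field_simp
  have := Real.log_le_sub_one_of_pos (show 0 < x / 200 by positivity)
  linarith

/-- The numerical inequality closing the proof of (1.10): for `0 < t ≤ 1/2`, `x ≥ 200`,
`4/x² + (t/2)(3/x + (1/2)(log x + π))/(x − 6) ≤ 0.02` (in print: `y((t/4) log(x/4π) + 3.21)/(x−6)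
≤ 0.02y`). [cite: Polymath2019, Prop. 6.6 (i), proof] -/
theorem numeric_bound {t x : ℝ} (ht : 0 < t) (ht' : t ≤ 1 / 2) (hx : 200 ≤ x) :
    4 / x ^ 2 + t / 2 * ((3 / x + 1 / 2 * (Real.log x + π)) * (1 / (x - 6))) ≤ 0.02 := by
  have hxpos : 0 < x := by linarith
  have hx6 : 0 < x - 6 := by linarith
  have hlog := log_le_linear hx
  have hπ := Real.pi_le_four
  have hlog0 : 0 ≤ Real.log x := Real.log_nonneg (by linarith)
  have h3x : 3 / x ≤ 3 / 200 := div_le_div_of_nonneg_left (by norm_num) (by norm_num) hx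
  have hinner : 3 / x + 1 / 2 * (Real.log x + π) ≤ x / 400 + 4.515 := by linarith
  have hinner0 : 0 ≤ 3 / x + 1 / 2 * (Real.log x + π) := by positivity
  have h1 : t / 2 * ((3 / x + 1 / 2 * (Real.log x + π)) * (1 / (x - 6))) ≤
      1 / 4 * ((x / 400 + 4.515) * (1 / (x - 6))) :=
    mul_le_mul (by linarith) (mul_le_mul_of_nonneg_right hinner (by positivity))
      (by positivity) (by norm_num)
  have h2 : 1 / 4 * ((x / 400 + 4.515) * (1 / (x - 6))) ≤ 0.0199 := by
    rw [← mul_assoc, mul_one_div, div_le_iff₀ hx6]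
    linarith
  have h3 : 4 / x ^ 2 ≤ 0.0001 := by
    rw [div_le_iff₀ (by positivity)]
    nlinarith
  linarith

/-- On the segment `Im s = x/2`, `0 ≤ Re s ≤ 1` (region (1.6)):
`Re((t/2) α α' + α) ≥ (1/2) log(x/4π) − 0.02`, i.e. `−(d/dσ) log|M_t(σ + ix/2)| ≤
−(1/2) log(x/4π) + 0.02` (the printed `log|γ| ≤ −(y/2) log(x/4π) + 0.02 y` per unit length).
[cite: Polymath2019, Prop. 6.6 (i), proof] -/
theorem re_deriv_logMt_ge {t x : ℝ} (ht : 0 < t) (ht' : t ≤ 1 / 2) (hx : 200 ≤ x) {s : ℂ}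
    (hs : s.im = x / 2) (h0 : 0 ≤ s.re) (h1 : s.re ≤ 1) :
    1 / 2 * Real.log (x / (4 * π)) - 0.02 ≤
      ((t : ℂ) / 4 * (2 * alpha s * (-(1 / (2 * s ^ 2)) - 1 / (s - 1) ^ 2 + 1 / (2 * s))) +
        alpha s).re := by
  have hxpos : 0 < x := by linarith
  set a := alpha s with ha
  set a' := -(1 / (2 * s ^ 2)) - 1 / (s - 1) ^ 2 + 1 / (2 * s) with ha'
  have hre : ((t : ℂ) / 4 * (2 * a * a') + a).re = t / 2 * (a * a').re + a.re := by
    rw [Complex.add_re, show (t : ℂ) / 4 * (2 * a * a') = ((t / 2 : ℝ) : ℂ) * (a * a') by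
      push_cast; ring, Complex.re_ofReal_mul]
  rw [hre]
  have hcross : -(‖a‖ * ‖a'‖) ≤ (a * a').re := by
    have h := Complex.abs_re_le_norm (a * a')
    rw [norm_mul] at h
    exact (abs_le.1 h).1
  have hα := re_alpha_ge hx hs h0 h1
  have hnα := norm_alpha_le hx hs h0 h1
  have hnα' := norm_deriv_alpha_le hx hs
  have hnum := numeric_bound ht ht' hx
  have hinner0 : 0 ≤ 3 / x + 1 / 2 * (Real.log x + π) := by
    have : 0 ≤ Real.log x := Real.log_nonneg (by linarith)
    positivity
  have hprod : ‖a‖ * ‖a'‖ ≤ (3 / x + 1 / 2 * (Real.log x + π)) * (1 / (x - 6)) :=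
    mul_le_mul hnα hnα' (norm_nonneg _) hinner0
  have ht2 : 0 ≤ t / 2 := by linarith
  linarith [mul_le_mul_of_nonneg_left hprod ht2, mul_le_mul_of_nonneg_left hcross ht2]

/-! ### Assembly -/

/-- **Proof of `gamma_bound` (Polymath 15, Thm. 1.3, (1.10); Prop. 6.6 (i)).** In the region (1.6),
`|γ| ≤ e^{0.02 y} (x/4π)^{−y/2}`. As printed: `log|γ| = log|M_t((1−y+ix)/2)| − log|M_t((1+y+ix)/2)|`
(`norm_Mt_conj`) `= −∫ (d/dσ) log|M_t(σ + ix/2)| dσ` over `σ ∈ [(1−y)/2, (1+y)/2]`, and the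
integrand is `Re((t/2) α α' + α) ≥ (1/2) log(x/4π) − 0.02` (`re_deriv_logMt_ge`, via the
monotonicity form of the mean value theorem on `[0, 1]`).
[cite: Polymath2019, Thm. 1.3 and Prop. 6.6 (i)] -/
theorem gamma_bound_holds : gamma_bound := by
  rintro t x y ⟨ht, ht', hy0, hy1, hx⟩
  have hxpos : 0 < x := by linarith
  set c : ℂ := ((x / 2 : ℝ) : ℂ) * I with hc
  set φ : ℝ → ℝ := fun σ ↦ (logMt t ((σ : ℂ) + c)).re with hφ
  have him : ∀ σ : ℝ, ((σ : ℂ) + c).im = x / 2 := by intro σ; simp [hc]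
  have hre : ∀ σ : ℝ, ((σ : ℂ) + c).re = σ := by intro σ; simp [hc]
  have hpos : ∀ σ : ℝ, 0 < ((σ : ℂ) + c).im := by intro σ; rw [him]; positivity
  have hderiv : ∀ σ : ℝ, HasDerivAt φ
      (((t : ℂ) / 4 * (2 * alpha ((σ : ℂ) + c) * (-(1 / (2 * ((σ : ℂ) + c) ^ 2)) -
        1 / (((σ : ℂ) + c) - 1) ^ 2 + 1 / (2 * ((σ : ℂ) + c)))) + alpha ((σ : ℂ) + c)).re) σ := by
    intro σ
    have h := hasDerivAt_logMt t (hpos σ)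
    have h2 := h.comp (σ : ℂ) ((hasDerivAt_id' (σ : ℂ)).add_const c)
    rw [mul_one] at h2
    exact h2.real_of_complex
  have hmono := (convex_Icc (0 : ℝ) 1).mul_sub_le_image_sub_of_le_deriv
      (f := φ) (fun σ _ ↦ (hderiv σ).continuousAt.continuousWithinAt)
      (fun σ _ ↦ (hderiv σ).differentiableAt.differentiableWithinAt)
      (C := 1 / 2 * Real.log (x / (4 * π)) - 0.02)
      (by
        intro σ hσ
        rw [interior_Icc] at hσ
        rw [(hderiv σ).deriv]
        exact re_deriv_logMt_ge ht ht' hx (him σ) (by rw [hre]; exact hσ.1.le)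
          (by rw [hre]; exact hσ.2.le))
      ((1 - y) / 2) ⟨by linarith, by linarith⟩ ((1 + y) / 2) ⟨by linarith, by linarith⟩
      (by linarith)
  -- identify the two values of `M_t`
  have hne0 : ∀ σ : ℝ, (σ : ℂ) + c ≠ 0 := fun σ h ↦ by
    have := hpos σ; rw [h] at this; simp at this
  have hne1 : ∀ σ : ℝ, (σ : ℂ) + c ≠ 1 := fun σ h ↦ by
    have := hpos σ; rw [h] at this; simp at this
  have hsm : sMinus x y = (((1 - y) / 2 : ℝ) : ℂ) + c := by
    simp only [sMinus, hc]
    push_cast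
    ring
  have hsp : sPlus x y = conj ((((1 + y) / 2 : ℝ) : ℂ) + c) := by
    simp only [sPlus, hc, map_add, Complex.conj_ofReal, map_mul, Complex.conj_I]
    push_cast
    ring
  have hnum_eq : ‖Mt t (sMinus x y)‖ = Real.exp (φ ((1 - y) / 2)) := by
    rw [hsm, norm_Mt_eq_exp t (hne0 _) (hne1 _)]
  have hden_eq : ‖Mt t (sPlus x y)‖ = Real.exp (φ ((1 + y) / 2)) := by
    rw [hsp, norm_Mt_conj t (hpos _).ne', norm_Mt_eq_exp t (hne0 _) (hne1 _)]
  rw [gamma, norm_div, hnum_eq, hden_eq, ← Real.exp_sub,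
    Real.rpow_def_of_pos (by positivity : 0 < x / (4 * π)), ← Real.exp_add, Real.exp_le_exp]
  have hy : (1 + y) / 2 - (1 - y) / 2 = y := by ring
  rw [hy] at hmono
  linarith [hmono]

end Polymath15

end Literature.NumberTheory.LFunctions

end
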